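import Summits.CriticalPhenomena.CardyFormulaZ2.Theorems.CardyFlipRussoVoronoiHubFromSmirnovGraphDefs
import Literature.Analysis.FunctionSpaces.PoissonMeckeProofs
import Mathlib.Combinatorics.SimpleGraph.Connectivity.Connected
import Mathlib.Analysis.SpecificLimits.Basic

/-!
# Stub `measurableSet_graphCross` of line `moebius-exact-delaunay-dilation-ward`
# (crux `VoronoiHubFromSmirnov`, stmt-CriticalPhenomena-6433, route `CardyFlipRusso`)

**The graph crossing event is measurable** (prerequisite of S3b-iii `Sig.stub_graphLaw`): for
measurable `K, A₀, A₂ ⊆ ℂ` and a mesh `δ`, the event `graphCross K A₀ A₂ δ` (GraphDefs module: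
some chain of black nuclei `p₀, …, p_N` of `c.1` with `δ pᵢ ∈ K`, `δ p₀ ∈ A₀`, `δ p_N ∈ A₂`,
consecutive nuclei Delaunay-adjacent with respect to all nuclei `c.1 ∪ c.2`) is measurable for
the product of the count σ-algebras.

Proof.
* Step A (loop erasure, `mgc_exists_injective_chain`, `mgc_graphCross_eq_iUnion`): chains may be
  taken injective without changing the event — in the simple graph on the admissible nuclei
  generated by Delaunay adjacency a chain gives reachability, and reachability is witnessed by a
  path (Mathlib's `SimpleGraph.Walk.toPath`). So `graphCross` is the countable union over `N` of
  the events "some injective admissible chain of length `N + 1`".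
* Step B (`mgc_measurableSet_exists_injective`): for a measurable constraint `H` on
  (tuple) × (two-colour configuration), the event "some injective tuple of nuclei of `c.1`
  satisfies `H` together with `c`" is the non-vanishing set of the sum over injective tuples of the
  indicator of `H`, which has a measurable version (the tree's `exists_measurable_tsum_injective`,
  s-finite counting kernel; Last–Penrose 2017, Prop. 2.7 / (4.9)).
* Step C (`mgc_isDelaunayPair_iff`, `mgc_measurableSet_isDelaunayPair`): Delaunay adjacency of two
  measurably parametrised points with respect to a measurably parametrised two-colour configuration
  is jointly measurable, via the BOUNDED approximate-centre characterisation of the empty-ball rule: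
  `p ~ q` iff for some bound `M : ℕ`, at every precision `1/(n+1)` some point `z` of a fixed
  countable dense sequence with `‖z‖ ≤ M` has `|dist z p - dist z q| ≤ 1/(n+1)` and
  `dist z p ≤ dist z w + 1/(n+1)` for all sites `w` ((⇐) by compactness of `closedBall 0 M`; the
  bound is essential). Each piece is a countable Boolean combination of closed conditions in the
  points and of void events of measurably parametrised sets
  (`PointConfig.measurableSet_count_preimage_eq_zero`).
* Step D: the carrier/attachment constraints are preimages of `K, A₀, A₂` under measurable
  coordinate maps; assemble with `MeasurableSet.iUnion`.

No new definitions; tree facts and Mathlib only. The hypothesis `0 < δ` of the registered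
signature is not used.

Sources: G. Last, M. Penrose, *Lectures on the Poisson Process* (CUP 2017), §2.2, §4.1 (Campbell
sums, factorial measures); J.-D. Boissonnat, M. Yvinec, *Algorithmic Geometry* (CUP 1998),
Thm 17.3.4 (empty-ball rule); I. Benjamini, O. Schramm, Comm. Math. Phys. 197 (1998) §2 (the
cluster event).
-/

noncomputable section

namespace Summit.CriticalPhenomena.CardyFormulaZ2.Cruxes.VoronoiHubFromSmirnov.MoebiusExactDelaunayDilationWard

open scoped Topology ENNReal
open Filter Set MeasureTheory Metric
open TopologicalSpace (denseSeq denseRange_denseSeq)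
open Literature.Analysis.FunctionSpaces
open Literature.Probability.LatticeModels (IsDelaunayPair voronoiCell)

/-! ### Step A: loop erasure — chains may be taken injective -/

/-- **Loop erasure.** For a symmetric relation `R` and a vertex predicate `Pv`, every chain
`p₀, …, p_N` of `Pv`-vertices with `R`-related consecutive entries can be replaced by an
INJECTIVE such chain with the same endpoints (pass to the simple graph on `{x // Pv x}`
generated by `R`, where the chain gives reachability, and reachability is witnessed by a path,
i.e. a walk without repeated vertices: Mathlib's `SimpleGraph.Walk.toPath`). [folklore] -/
theorem mgc_exists_injective_chain {X : Type*} {R : X → X → Prop} (hR : ∀ x y, R x y → R y x)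
    {Pv : X → Prop} {N : ℕ} {p : Fin (N + 1) → X} (hP : ∀ i, Pv (p i))
    (hadj : ∀ i : Fin N, R (p i.castSucc) (p i.succ)) :
    ∃ (N' : ℕ) (p' : Fin (N' + 1) → X), Function.Injective p' ∧ (∀ i, Pv (p' i)) ∧
      p' 0 = p 0 ∧ p' (Fin.last N') = p (Fin.last N) ∧
      ∀ i : Fin N', R (p' i.castSucc) (p' i.succ) := by
  classical
  -- the simple graph on admissible vertices generated by `R`, and the chain as its vertices
  set G : SimpleGraph {x // Pv x} := SimpleGraph.fromRel fun x y => R x.1 y.1 with hG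
  set v : Fin (N + 1) → {x // Pv x} := fun i => ⟨p i, hP i⟩ with hv
  have hreach : ∀ i : Fin (N + 1), G.Reachable (v 0) (v i) := by
    refine Fin.induction (SimpleGraph.Reachable.refl _) fun i ih => ih.trans ?_
    by_cases heq : v i.castSucc = v i.succ
    · rw [heq]
    · refine SimpleGraph.Adj.reachable ?_
      rw [hG, SimpleGraph.fromRel_adj]
      exact ⟨heq, Or.inl (hadj i)⟩
  refine (hreach (Fin.last N)).elim_path fun q => ?_
  refine ⟨q.1.length, fun i => (q.1.getVert i).1, ?_, fun i => (q.1.getVert i).2,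
    ?_, ?_, ?_⟩
  · intro i j hij
    have hi : (i : ℕ) ∈ {k | k ≤ q.1.length} := Nat.lt_succ_iff.1 i.2
    have hj : (j : ℕ) ∈ {k | k ≤ q.1.length} := Nat.lt_succ_iff.1 j.2
    exact Fin.ext (q.2.getVert_injOn hi hj (Subtype.ext hij))
  · change (q.1.getVert 0).1 = p 0
    rw [SimpleGraph.Walk.getVert_zero]
  · change (q.1.getVert q.1.length).1 = p (Fin.last N)
    rw [SimpleGraph.Walk.getVert_length]
  · intro i
    have h := (SimpleGraph.fromRel_adj _ _ _).1 (q.1.adj_getVert_succ (i := i) i.2)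
    rcases h.2 with h' | h'
    · simpa using h'
    · simpa using hR _ _ h'

/-- `graphCross` is the countable union over the chain length `N` of the events "some INJECTIVE
admissible chain of `N + 1` black nuclei" (loop erasure, `mgc_exists_injective_chain`; the other
inclusion forgets injectivity). [folklore] -/
theorem mgc_graphCross_eq_iUnion (K A₀ A₂ : Set ℂ) (δ : ℝ) :
    graphCross K A₀ A₂ δ = ⋃ N : ℕ, {c : PointConfig ℂ × PointConfig ℂ |
      ∃ p : Fin (N + 1) → ℂ, Function.Injective p ∧ (∀ i, p i ∈ c.1) ∧
        ((∀ i, (δ : ℂ) * p i ∈ K) ∧ (δ : ℂ) * p 0 ∈ A₀ ∧ (δ : ℂ) * p (Fin.last N) ∈ A₂ ∧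
        ∀ i : Fin N,
          IsDelaunayPair ((c.1 : Set ℂ) ∪ (c.2 : Set ℂ)) (p i.castSucc) (p i.succ))} := by
  ext c
  simp only [graphCross, mem_setOf_eq, mem_iUnion]
  constructor
  · rintro ⟨N, p, hmem, hK, h0, hlast, hadj⟩
    obtain ⟨N', p', hinj, hP, h0', hlast', hadj'⟩ :=
      mgc_exists_injective_chain (X := ℂ) (Pv := fun x => x ∈ c.1 ∧ (δ : ℂ) * x ∈ K)
        (fun x y (h : IsDelaunayPair ((c.1 : Set ℂ) ∪ (c.2 : Set ℂ)) x y) => h.symm)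
        (fun i => ⟨hmem i, hK i⟩) hadj
    refine ⟨N', p', hinj, fun i => (hP i).1, fun i => (hP i).2, ?_, ?_, hadj'⟩
    · rw [h0']; exact h0
    · rw [hlast']; exact hlast
  · rintro ⟨N, p, -, hmem, hK, h0, hlast, hadj⟩
    exact ⟨N, p, hmem, hK, h0, hlast, hadj⟩

/-! ### Step B: events "some injective tuple of black nuclei satisfies a jointly measurable
constraint" are measurable -/

/-- For a measurable constraint `H` on (tuple, two-colour configuration), the event that some
injective `m`-tuple of nuclei of the first colour satisfies `H` together with the configuration is
measurable: it is the non-vanishing set of the Campbell-type sum over injective tuples of the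
indicator of `H`, which has a measurable version by the tree's `exists_measurable_tsum_injective`
(s-finite counting kernel, parameter = the configuration pair; every configuration of `ℂ` is
countable). [folklore] -/
theorem mgc_measurableSet_exists_injective (m : ℕ)
    {H : Set ((Fin m → ℂ) × (PointConfig ℂ × PointConfig ℂ))} (hH : MeasurableSet H) :
    MeasurableSet {c : PointConfig ℂ × PointConfig ℂ |
      ∃ y : Fin m → ℂ, Function.Injective y ∧ (∀ i, y i ∈ c.1) ∧ (y, c) ∈ H} := by
  classical
  obtain ⟨Φ, hΦm, hΦ⟩ := IsPoissonPointProcess.exists_measurable_tsum_injective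
    (PointConfig.countKernel (E := ℂ)) univ (fun c _ => PointConfig.countKernel_apply c)
    (fun c _ => c.countable_carrier) m (α := PointConfig ℂ × PointConfig ℂ)
    (fun q => H.indicator (fun _ => (1 : ℝ≥0∞)) (q.2.1, q.1))
    ((measurable_const.indicator hH).comp (measurable_snd.fst.prodMk measurable_fst))
  have heq : {c : PointConfig ℂ × PointConfig ℂ |
      ∃ y : Fin m → ℂ, Function.Injective y ∧ (∀ i, y i ∈ c.1) ∧ (y, c) ∈ H} =
      (fun c => Φ (c, c.1)) ⁻¹' ({0} : Set ℝ≥0∞)ᶜ := by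
    ext c
    simp only [mem_setOf_eq, mem_preimage, mem_compl_iff, mem_singleton_iff]
    rw [hΦ c c.1 (mem_univ _), ENNReal.tsum_eq_zero, not_forall]
    constructor
    · rintro ⟨y, hinj, hmem, hyH⟩
      exact ⟨⟨y, hinj, hmem⟩, by simp [hyH]⟩
    · rintro ⟨⟨y, hinj, hmem⟩, hy⟩
      refine ⟨y, hinj, hmem, ?_⟩
      by_contra hyH
      exact hy (indicator_of_notMem hyH _)
  rw [heq]
  exact (hΦm.comp (measurable_id.prodMk measurable_fst)) ((measurableSet_singleton 0).compl)

/-! ### Step C: Delaunay adjacency is jointly measurable (bounded approximate centres) -/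

/-- **Bounded approximate-centre characterisation of the empty-ball rule** (valid for every set of
sites `τ ⊆ ℂ`): `p ~ q` iff for some bound `M`, at every precision `1/(n+1)` there is a point
`z` of the fixed countable dense sequence `denseSeq ℂ` with `‖z‖ ≤ M`,
`|dist z p - dist z q| ≤ 1/(n+1)` and `dist z p ≤ dist z w + 1/(n+1)` for all sites `w`.
(⇒) approximate a true centre; (⇐) the approximate centres lie in the compact `closedBall 0 M`,
a subsequence converges, and the closed conditions pass to the limit.  The bound `M` is
essential (collinear `p, w, q` with `w` the midpoint has unbounded approximate centres but is not
a Delaunay pair). [folklore] -/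
theorem mgc_isDelaunayPair_iff (τ : Set ℂ) (p q : ℂ) :
    IsDelaunayPair τ p q ↔ ∃ M : ℕ, ∀ n : ℕ, ∃ k : ℕ, ‖denseSeq ℂ k‖ ≤ M ∧
      |dist (denseSeq ℂ k) p - dist (denseSeq ℂ k) q| ≤ 1 / ((n : ℝ) + 1) ∧
      ∀ w ∈ τ, dist (denseSeq ℂ k) p ≤ dist (denseSeq ℂ k) w + 1 / ((n : ℝ) + 1) := by
  constructor
  · rintro ⟨c₀, r, hp, hq, hr⟩
    refine ⟨⌈‖c₀‖⌉₊ + 1, fun n => ?_⟩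
    have hε : (0 : ℝ) < 1 / ((n : ℝ) + 1) := Nat.one_div_pos_of_nat
    obtain ⟨k, hk⟩ := Metric.denseRange_iff.1 (denseRange_denseSeq ℂ) c₀ _ (half_pos hε)
    have hd : dist (denseSeq ℂ k) c₀ < 1 / ((n : ℝ) + 1) / 2 := by rwa [dist_comm]
    have h1 := abs_dist_sub_le (denseSeq ℂ k) c₀ p
    have h2 := abs_dist_sub_le (denseSeq ℂ k) c₀ q
    rw [dist_comm c₀ p, hp, abs_le] at h1
    rw [dist_comm c₀ q, hq, abs_le] at h2
    refine ⟨k, ?_, ?_, fun w hw => ?_⟩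
    · have h3 := dist_triangle (denseSeq ℂ k) c₀ 0
      rw [dist_zero_right, dist_zero_right] at h3
      have h4 : ‖c₀‖ ≤ ⌈‖c₀‖⌉₊ := Nat.le_ceil _
      have h5 : 1 / ((n : ℝ) + 1) ≤ 1 := by
        rw [div_le_one (by positivity)]
        linarith [(Nat.cast_nonneg n : (0 : ℝ) ≤ n)]
      push_cast
      linarith
    · rw [abs_le]
      constructor <;> linarith
    · have h3 := hr w hw
      have h4 := dist_triangle w (denseSeq ℂ k) c₀
      rw [dist_comm w (denseSeq ℂ k)] at h4
      linarith
  · rintro ⟨M, hM⟩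
    choose k hk using hM
    have hzK : ∀ n, denseSeq ℂ (k n) ∈ closedBall (0 : ℂ) M := fun n =>
      mem_closedBall_zero_iff.2 (hk n).1
    obtain ⟨z₀, -, φ, hφ, hlim⟩ := (isCompact_closedBall (0 : ℂ) (M : ℝ)).tendsto_subseq hzK
    have hε : Tendsto (fun n => 1 / ((φ n : ℝ) + 1)) atTop (𝓝 0) :=
      tendsto_one_div_add_atTop_nhds_zero_nat.comp hφ.tendsto_atTop
    have hpq : dist z₀ p = dist z₀ q := by
      have hc : Continuous fun x : ℂ => |dist x p - dist x q| := by fun_prop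
      have h1 := (hc.tendsto z₀).comp hlim
      have h2 : |dist z₀ p - dist z₀ q| ≤ 0 :=
        le_of_tendsto_of_tendsto' h1 hε fun n => (hk (φ n)).2.1
      have h3 : |dist z₀ p - dist z₀ q| = 0 := le_antisymm h2 (abs_nonneg _)
      rwa [abs_eq_zero, sub_eq_zero] at h3
    have hle : ∀ w ∈ τ, dist z₀ p ≤ dist z₀ w := fun w hw => by
      have h1 : Tendsto (fun n => dist ((fun n => denseSeq ℂ (k n)) (φ n)) p) atTop
          (𝓝 (dist z₀ p)) := hlim.dist tendsto_const_nhds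
      have h2 : Tendsto
          (fun n => dist ((fun n => denseSeq ℂ (k n)) (φ n)) w + 1 / ((φ n : ℝ) + 1))
          atTop (𝓝 (dist z₀ w + 0)) := (hlim.dist tendsto_const_nhds).add hε
      rw [add_zero] at h2
      exact le_of_tendsto_of_tendsto' h1 h2 fun n => (hk (φ n)).2.2 w hw
    refine ⟨z₀, dist p z₀, rfl, by rw [dist_comm, ← hpq, dist_comm], fun w hw => ?_⟩
    rw [dist_comm p, dist_comm w]
    exact hle w hw

/-- Parametrised approximate void condition: for measurable `f : α → ℂ`, a measurable family of
configurations `c' a`, a point `z` and `ε`, the set of parameters with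
`dist z (f a) ≤ dist z w + ε` for every nucleus `w` of `c' a` is measurable — it is the void event
of the measurably parametrised set `{w | dist z w + ε < dist z (f a)}`
(`PointConfig.measurableSet_count_preimage_eq_zero`). [folklore] -/
theorem mgc_measurableSet_forall_dist_le {α : Type*} [MeasurableSpace α] {f : α → ℂ}
    (hf : Measurable f) {c' : α → PointConfig ℂ} (hc' : Measurable c') (z : ℂ) (ε : ℝ) :
    MeasurableSet {a | ∀ w ∈ c' a, dist z (f a) ≤ dist z w + ε} := by
  have ht : MeasurableSet {q : α × ℂ | dist z q.2 + ε < dist z (f q.1)} :=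
    measurableSet_lt ((measurable_const.dist measurable_snd).add_const ε)
      (measurable_const.dist (hf.comp measurable_fst))
  have hset : {a | ∀ w ∈ c' a, dist z (f a) ≤ dist z w + ε} =
      {a | (c' a).count (Prod.mk a ⁻¹' {q : α × ℂ | dist z q.2 + ε < dist z (f q.1)}) = 0} := by
    ext a
    simp only [mem_setOf_eq, PointConfig.count, Set.encard_eq_zero,
      Set.eq_empty_iff_forall_notMem, mem_inter_iff, mem_preimage, mem_setOf_eq, not_and,
      not_lt, PointConfig.mem_carrier]
  rw [hset]
  exact PointConfig.measurableSet_count_preimage_eq_zero ht hc'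

/-- **Delaunay adjacency with respect to a two-colour configuration is jointly measurable**: for
measurable `f, g : α → ℂ` and measurable `c₁, c₂ : α → PointConfig ℂ`, the set of parameters with
`IsDelaunayPair (c₁ a ∪ c₂ a) (f a) (g a)` is measurable (countable operations on the measurable
pieces of `mgc_isDelaunayPair_iff`). [folklore] -/
theorem mgc_measurableSet_isDelaunayPair {α : Type*} [MeasurableSpace α] {f g : α → ℂ}
    (hf : Measurable f) (hg : Measurable g) {c₁ c₂ : α → PointConfig ℂ} (hc₁ : Measurable c₁)
    (hc₂ : Measurable c₂) :
    MeasurableSet {a | IsDelaunayPair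
      (((c₁ a : PointConfig ℂ) : Set ℂ) ∪ ((c₂ a : PointConfig ℂ) : Set ℂ)) (f a) (g a)} := by
  have key : {a | IsDelaunayPair
      (((c₁ a : PointConfig ℂ) : Set ℂ) ∪ ((c₂ a : PointConfig ℂ) : Set ℂ)) (f a) (g a)} =
      ⋃ M : ℕ, ⋂ n : ℕ, ⋃ k : ℕ, ({_a : α | ‖denseSeq ℂ k‖ ≤ M} ∩
        ({a | |dist (denseSeq ℂ k) (f a) - dist (denseSeq ℂ k) (g a)| ≤ 1 / ((n : ℝ) + 1)} ∩
        ({a | ∀ w ∈ c₁ a,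
            dist (denseSeq ℂ k) (f a) ≤ dist (denseSeq ℂ k) w + 1 / ((n : ℝ) + 1)} ∩
         {a | ∀ w ∈ c₂ a,
            dist (denseSeq ℂ k) (f a) ≤ dist (denseSeq ℂ k) w + 1 / ((n : ℝ) + 1)}))) := by
    ext a
    simp only [mem_setOf_eq, mgc_isDelaunayPair_iff, mem_iUnion, mem_iInter, mem_inter_iff,
      Set.mem_union, SetLike.mem_coe, or_imp, forall_and]
  rw [key]
  refine MeasurableSet.iUnion fun M => MeasurableSet.iInter fun n =>
    MeasurableSet.iUnion fun k => (MeasurableSet.const _).inter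
      ((measurableSet_le ?_ measurable_const).inter
        ((mgc_measurableSet_forall_dist_le hf hc₁ _ _).inter
          (mgc_measurableSet_forall_dist_le hf hc₂ _ _)))
  exact continuous_abs.measurable.comp
    ((measurable_const.dist hf).sub (measurable_const.dist hg))

/-- The chain constraint of `graphCross` at fixed length — carrier, attachments and consecutive
Delaunay adjacency — is a measurable subset of (tuple) × (two-colour configuration). [folklore] -/
theorem mgc_measurableSet_chainConstraint {K A₀ A₂ : Set ℂ} (hK : MeasurableSet K)
    (hA₀ : MeasurableSet A₀) (hA₂ : MeasurableSet A₂) (δ : ℝ) (N : ℕ) :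
    MeasurableSet {q : (Fin (N + 1) → ℂ) × (PointConfig ℂ × PointConfig ℂ) |
      (∀ i, (δ : ℂ) * q.1 i ∈ K) ∧ (δ : ℂ) * q.1 0 ∈ A₀ ∧ (δ : ℂ) * q.1 (Fin.last N) ∈ A₂ ∧
      ∀ i : Fin N, IsDelaunayPair
        (((q.2.1 : PointConfig ℂ) : Set ℂ) ∪ ((q.2.2 : PointConfig ℂ) : Set ℂ))
        (q.1 i.castSucc) (q.1 i.succ)} := by
  have hcoord : ∀ i : Fin (N + 1), Measurable
      fun q : (Fin (N + 1) → ℂ) × (PointConfig ℂ × PointConfig ℂ) => (δ : ℂ) * q.1 i :=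
    fun i => ((measurable_pi_apply i).comp measurable_fst).const_mul _
  simp only [Set.setOf_and, Set.setOf_forall]
  exact (MeasurableSet.iInter fun i => hcoord i hK).inter ((hcoord 0 hA₀).inter
    ((hcoord _ hA₂).inter (MeasurableSet.iInter fun i => mgc_measurableSet_isDelaunayPair
      ((measurable_pi_apply _).comp measurable_fst) ((measurable_pi_apply _).comp measurable_fst)
      measurable_snd.fst measurable_snd.snd)))

/-! ### Step D: assembly -/

/-- **The graph crossing event is measurable** (registered stub `measurableSet_graphCross` of line
`moebius-exact-delaunay-dilation-ward`, S3b-iii prerequisite): for measurable carrier `K` and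
attachments `A₀, A₂` (and any mesh `δ`), `graphCross K A₀ A₂ δ` is a measurable set of
two-colour configurations — countable union over the chain length of the events of Step B with
the measurable chain constraint of Step C, after the loop-erasure reduction of Step A.
[folklore] -/
theorem measurableSet_graphCross : ∀ (K A₀ A₂ : Set ℂ) (δ : ℝ), MeasurableSet K → MeasurableSet A₀ → MeasurableSet A₂ → 0 < δ → MeasurableSet (graphCross K A₀ A₂ δ) := by
  intro K A₀ A₂ δ hK hA₀ hA₂ _
  rw [mgc_graphCross_eq_iUnion]
  exact MeasurableSet.iUnion fun N =>
    mgc_measurableSet_exists_injective (N + 1) (mgc_measurableSet_chainConstraint hK hA₀ hA₂ δ N)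

end Summit.CriticalPhenomena.CardyFormulaZ2.Cruxes.VoronoiHubFromSmirnov.MoebiusExactDelaunayDilationWard

end
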